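import Mathlib
import Literature.NumberTheory.Automorphic.HilbertModularFormQExpansion
import Summits.Langlands.Langlands.Theorems.CapacityClassicalityHilbertIntegralOverconvergentIsCongruenceSliceDerivForms
import Summits.Langlands.Langlands.Theorems.CapacityClassicalityHilbertIntegralOverconvergentIsCongruenceStubSliceDerivLaw
import Summits.Langlands.Langlands.Theorems.CapacityClassicalityHilbertIntegralOverconvergentIsCongruenceStubBracketLeadCoeff
import Summits.Langlands.Langlands.Theorems.CapacityClassicalityHilbertIntegralOverconvergentIsCongruenceStubBracketEdata
import Summits.Langlands.Langlands.Theorems.CapacityClassicalityHilbertIntegralOverconvergentIsCongruenceStubCauchyProductTube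
import Summits.Langlands.Langlands.Theorems.CapacityClassicalityHilbertIntegralOverconvergentIsCongruenceStubFourierCoeffMul
import Summits.Langlands.Langlands.Theorems.CapacityClassicalityHilbertIntegralOverconvergentIsCongruenceStubFourierCoeffLinear
import Summits.Langlands.Langlands.Theorems.CapacityClassicalityHilbertIntegralOverconvergentIsCongruenceStubFiniteQIndexAntidiagonal
import Summits.Langlands.Langlands.Theorems.CapacityClassicalityHilbertIntegralOverconvergentIsCongruenceStubModularFormCoeffSupport
import Summits.Langlands.Langlands.Theorems.CapacityClassicalityHilbertIntegralOverconvergentIsCongruenceSeedLeadingExponents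
import Summits.Langlands.Langlands.Theorems.CapacityClassicalityHilbertIntegralOverconvergentIsCongruenceSeedSupplyPrelim
import Summits.Langlands.Langlands.Theorems.CapacityClassicalityHilbertIntegralOverconvergentIsCongruenceStubGenericHeight
import Summits.Langlands.Langlands.Theorems.CapacityClassicalityHilbertIntegralOverconvergentIsCongruenceStubSeedOfNonconstant
import Summits.Langlands.Langlands.Theorems.CapacityClassicalityHilbertIntegralOverconvergentIsCongruenceStubSlashMul
import Summits.Langlands.Langlands.Theorems.CapacityClassicalityHilbertIntegralOverconvergentIsCongruenceHilbertClassicalityAdmissibleExists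

/-!
# The Rankin–Cohen bump form at a place (line Sketch-ideate-r1-k1, § X, lead part 2)

Lead's construction for RESHAPE 20 (§ X) of line Sketch-ideate-r1-k1 of the crux `HilbertIntegralOverconvergentIsCongruence`
(stmt-Langlands-8485): `tx_bump`.  From a weight-one Hilbert modular form `h` of level `Γ₁(𝔫)` with integer coefficients and
`a₀(h) ≠ 0`, `a₁(h) ≠ 0` (the weight-one theta seed of § W), a real place `σ` and an embedding `ι : F → E` with `τ ∘ ι = σ`, the
BUMP FORM `B_σ := 1_ℍ · (2πi)⁻¹ d_F · [s, h]_σ`, where `s = h - h(2·)` is the seed of `h` (landed U9) and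
`[s,h]_σ = s ∂_σ h - h ∂_σ s` the first Rankin–Cohen bracket at `σ`, is a Hilbert modular form of the NON-PARALLEL weight
`2·𝟙 + 2e_σ` and level `Γ₁(2𝔫)` (transformation law of the bracket, stub X2; Koecher principle), it does not vanish identically
(its Fourier coefficient at the `λ`-minimal index `ν⋆` of `s`, for a generic height `λ`, is
`(2πi)⁻¹ d_F · (-2πi σ(ν⋆) a₀(h) a_{ν⋆}(s)) ≠ 0` — stub X4 with the product formula for the coefficients of `s ∂_σ h`, `h ∂_σ s`),
and its coefficients `∑_{μ+μ'=ν} σ(d_F μ')(a_μ(s) a_μ'(h) - a_μ(h) a_μ'(s))` are `E`-rational, `𝓞_E`-integral and tube-summable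
under every conjugate (stub X5, with the majorant from stub X6 and the Fourier expansions of `s`, `h`).
-/

set_option linter.dupNamespace false

noncomputable section

namespace Summit.Langlands.Langlands.Theorems.HilbertIntegralOverconvergentIsCongruence

open MeasureTheory Complex NumberField
open Literature.NumberTheory.Automorphic Literature.NumberTheory.Automorphic.HilbertModular
open scoped MatrixGroups

/-- The additive height `λ_y(ν) = ∑_σ y_σ σ(ν)` as an additive monoid hom. [folklore] -/
theorem tx_height_hom (F : Type) [Field F] [NumberField F] (y : (F →+* ℝ) → ℝ) :
    ∃ lam : F →+ ℝ, ∀ ν, lam ν = ∑ σ : F →+* ℝ, y σ * σ ν :=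
  ⟨{ toFun := fun ν ↦ ∑ σ : F →+* ℝ, y σ * σ ν
     map_zero' := by simp
     map_add' := fun a b ↦ by simp only [map_add, mul_add, Finset.sum_add_distrib] }, fun _ ↦ rfl⟩

/-- A holomorphic `𝓞F`-periodic function on `ℍ` all of whose Fourier coefficients vanish is `0` on `ℍ`
(Fourier expansion `hasSum_fourierCoeff`). [folklore] -/
theorem tx_exists_coeff_ne_zero (F : Type) [Field F] [NumberField F] [NumberField.IsTotallyReal F]
    (f : Point F → ℂ) (hf : IsHolomorphicOn F f)
    (hper : ∀ (a : 𝓞 F) (z : Point F), z ∈ halfSpace F → f (fun σ ↦ z σ + ((σ (a : F) : ℝ) : ℂ)) = f z)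
    (hnz : ∃ z ∈ halfSpace F, f z ≠ 0) :
    ∃ ν : F, (∀ a : 𝓞 F, ∃ n : ℤ, Algebra.trace ℚ F (ν * a) = n) ∧ fourierCoeff f ν ≠ 0 := by
  by_contra hall
  push Not at hall
  obtain ⟨z, hz, hfz⟩ := hnz
  apply hfz
  have hsum := (hasSum_fourierCoeff F f hf hper z hz).1
  have h0 : HasSum (fun ν : {ν : F | ∀ a : 𝓞 F, ∃ n : ℤ, Algebra.trace ℚ F (ν * a) = n} ↦
      fourierCoeff f ν * cexp (2 * Real.pi * I * pairing (ν : F) z)) 0 := by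
    have : (fun ν : {ν : F | ∀ a : 𝓞 F, ∃ n : ℤ, Algebra.trace ℚ F (ν * a) = n} ↦
        fourierCoeff f ν * cexp (2 * Real.pi * I * pairing (ν : F) z)) = fun _ ↦ 0 := by
      funext ν
      rw [hall ν ν.2, zero_mul]
    rw [this]
    exact hasSum_zero
  exact hsum.unique h0

open Classical in
/-- **The bump form at a place `σ` (lead, § X).**  From a weight-one form `h` of level `Γ₁(𝔫)` with integer coefficients and
`a₀(h) ≠ 0`, `a₁(h) ≠ 0` (the weight-one theta seed) we get, for every real place `σ` and every coefficient field `E ∋ ι(F)`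
with `τ ∘ ι = σ`: the form `B_σ = 1_ℍ · (2πi)⁻¹ d_F [s, h]_σ`, `s = h - h(2·)` the seed of `h`, of weight `2·𝟙 + 2e_σ` and level
`Γ₁(2𝔫)`, not identically zero, with `E`-rational `𝓞_E`-integral tube-summable coefficient data (stubs X1–X5, the landed seed
construction U9, product formula, Koecher principle, generic heights). [folklore] -/
theorem tx_bump (F : Type) [Field F] [NumberField F] [NumberField.IsTotallyReal F] (hd : 1 < Module.finrank ℚ F)
    (𝔫 : Ideal (𝓞 F)) (h𝔫 : 𝔫 ≠ ⊥) (h : Point F → ℂ) (hh : h ∈ modularForms (Bianchi.Gamma1 𝔫) (fun _ ↦ (1 : ℤ)))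
    (zh : F → ℤ) (hzh : ∀ ν ∈ qIndexSet F, fourierCoeff h ν = (zh ν : ℂ)) (hh0 : fourierCoeff h 0 ≠ 0)
    (hh1 : fourierCoeff h 1 ≠ 0) (E : Type) [Field E] [NumberField E] (τ : E →+* ℂ) (σ : F →+* ℝ) (ι : F →+* E)
    (hι : ∀ x : F, τ (ι x) = ((σ x : ℝ) : ℂ)) :
    ∃ B : Point F → ℂ,
      B ∈ modularForms (Bianchi.Gamma1 (𝔫 * Ideal.span {(2 : 𝓞 F)})) (fun σ' ↦ (2 : ℤ) + (Pi.single σ (2 : ℤ) : (F →+* ℝ) → ℤ) σ') ∧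
      (∃ z ∈ halfSpace F, B z ≠ 0) ∧
      ∃ qB : F → E, (∀ ν ∈ qIndexSet F, fourierCoeff B ν = τ (qB ν)) ∧ (∀ ν, IsIntegral ℤ (qB ν)) ∧
        ∀ (τ' : E →+* ℂ) (y : (F →+* ℝ) → ℝ), (∀ σ', 0 < y σ') →
          Summable (fun ν : {ν : F | ∀ b : 𝓞 F, ∃ n : ℤ, Algebra.trace ℚ F (ν * b) = n} ↦
            ‖τ' (qB ν)‖ * Real.exp (-(2 * Real.pi * ∑ σ' : F →+* ℝ, σ' (ν : F) * y σ'))) := by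
  set D : Set F := {ν : F | ∀ b : 𝓞 F, ∃ n : ℤ, Algebra.trace ℚ F (ν * b) = n} with hD
  -- the seed of `h`
  set s : Point F → ℂ := fun z ↦ h z - h (fun σ' ↦ ((σ' ((2 : 𝓞 F) : F) : ℝ) : ℂ) * z σ') with hs_def
  obtain ⟨hs, hs0, hsnz, zs, hzs⟩ := stub_seed_of_nonconstant F hd 𝔫 h𝔫 (fun _ ↦ (1 : ℤ)) h hh zh hzh
    ⟨1, hcm_one_mem_qIndexSet F, one_ne_zero, hh1⟩
  set 𝔫₂ : Ideal (𝓞 F) := 𝔫 * Ideal.span {(2 : 𝓞 F)} with h𝔫₂def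
  have h𝔫₂ : 𝔫₂ ≠ ⊥ :=
    Ideal.mul_eq_bot.not.mpr (not_or.mpr ⟨h𝔫, Ideal.span_singleton_eq_bot.not.mpr two_ne_zero⟩)
  have hh₂ : h ∈ modularForms (Bianchi.Gamma1 𝔫₂) (fun _ ↦ (1 : ℤ)) :=
    modularForms_mono (ssp_gamma1_mono Ideal.mul_le_right) _ hh
  have hh_hol : IsHolomorphicOn F h := (mem_modularForms_iff.mp hh₂).holomorphic
  have hs_hol : IsHolomorphicOn F s := (mem_modularForms_iff.mp hs).holomorphic
  have hh_per := stub_modularForm_periodic F 𝔫₂ _ h hh₂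
  have hs_per := stub_modularForm_periodic F 𝔫₂ _ s hs
  have hh_supp : ∀ μ : F, μ ∈ D → μ ∉ qIndexSet F → fourierCoeff h μ = 0 := fun μ hμ hμc ↦
    stub_modularForm_coeff_support F hd 𝔫₂ h𝔫₂ _ h hh₂ μ hμ hμc
  have hs_supp : ∀ μ : F, μ ∈ D → μ ∉ qIndexSet F → fourierCoeff s μ = 0 := fun μ hμ hμc ↦
    stub_modularForm_coeff_support F hd 𝔫₂ h𝔫₂ _ s hs μ hμ hμc
  -- the derivatives
  obtain ⟨hDh_hol, hDh_per, hDh_coeff⟩ := tx_deriv_form_data F 𝔫₂ _ σ h hh₂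
  obtain ⟨hDs_hol, hDs_per, hDs_coeff⟩ := tx_deriv_form_data F 𝔫₂ _ σ s hs
  set Dh : Point F → ℂ := fun z ↦ deriv (fun t : ℂ ↦ h (Function.update z σ t)) (z σ) with hDh
  set Ds : Point F → ℂ := fun z ↦ deriv (fun t : ℂ ↦ s (Function.update z σ t)) (z σ) with hDs
  have hDh_per' : ∀ (a : 𝓞 F) (z : Point F), z ∈ halfSpace F →
      Dh (fun σ' ↦ z σ' + ((σ' (a : F) : ℝ) : ℂ)) = Dh z := fun a z hz ↦ by
    simp only [hDh]
    exact hDh_per a z hz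
  have hDs_per' : ∀ (a : 𝓞 F) (z : Point F), z ∈ halfSpace F →
      Ds (fun σ' ↦ z σ' + ((σ' (a : F) : ℝ) : ℂ)) = Ds z := fun a z hz ↦ by
    simp only [hDs]
    exact hDs_per a z hz
  have hDh_supp : ∀ μ : F, μ ∈ D → μ ∉ qIndexSet F → fourierCoeff Dh μ = 0 := fun μ hμ hμc ↦ by
    rw [hDh_coeff μ hμ, hh_supp μ hμ hμc, mul_zero]
  have hDs_supp : ∀ μ : F, μ ∈ D → μ ∉ qIndexSet F → fourierCoeff Ds μ = 0 := fun μ hμ hμc ↦ by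
    rw [hDs_coeff μ hμ, hs_supp μ hμ hμc, mul_zero]
  -- antidiagonals
  have hT : ∀ ν : F, ∀ μ : F × F, μ ∈ (stub_finite_qIndex_antidiagonal F ν).toFinset ↔
      μ.1 ∈ qIndexSet F ∧ μ.2 ∈ qIndexSet F ∧ μ.1 + μ.2 = ν := fun ν μ ↦ by
    rw [Set.Finite.mem_toFinset]; rfl
  set T : F → Finset (F × F) := fun ν ↦ (stub_finite_qIndex_antidiagonal F ν).toFinset with hTdef
  have hTuniq : ∀ (ν : F) (T' : Finset (F × F)),
      (∀ μ : F × F, μ ∈ T' ↔ μ.1 ∈ qIndexSet F ∧ μ.2 ∈ qIndexSet F ∧ μ.1 + μ.2 = ν) → T' = T ν :=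
    fun ν T' hT' ↦ Finset.ext fun μ ↦ by rw [hT' μ, hT ν μ]
  -- the bracket and its coefficients
  set Br : Point F → ℂ := s * Dh - h * Ds with hBr
  have hc1 : ∀ ν : F, ν ∈ D → fourierCoeff (s * Dh) ν = ∑ μ ∈ T ν, fourierCoeff s μ.1 * fourierCoeff Dh μ.2 :=
    fun ν hν ↦ stub_fourierCoeff_mul F s Dh hs_hol hDh_hol hs_per hDh_per' hs_supp hDh_supp ν hν _ (hT ν)
  have hc2 : ∀ ν : F, ν ∈ D → fourierCoeff (h * Ds) ν = ∑ μ ∈ T ν, fourierCoeff h μ.1 * fourierCoeff Ds μ.2 :=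
    fun ν hν ↦ stub_fourierCoeff_mul F h Ds hh_hol hDs_hol hh_per hDs_per' hh_supp hDs_supp ν hν _ (hT ν)
  have hBr_hol : IsHolomorphicOn F Br := (hs_hol.mul hDh_hol).sub (hh_hol.mul hDs_hol)
  have hBr_coeff : ∀ ν : F, fourierCoeff Br ν = fourierCoeff (s * Dh) ν - fourierCoeff (h * Ds) ν := by
    intro ν
    have hc_sDh : ContinuousOn (s * Dh) (halfSpace F) := (hs_hol.mul hDh_hol).continuousOn
    have hc_hDs : ContinuousOn (h * Ds) (halfSpace F) := (hh_hol.mul hDs_hol).continuousOn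
    have hc_neg : ContinuousOn ((-1 : ℂ) • (h * Ds)) (halfSpace F) := hc_hDs.const_smul (-1 : ℂ)
    obtain ⟨hadd, -, -⟩ := stub_fourierCoeff_linear F (s * Dh) ((-1 : ℂ) • (h * Ds)) hc_sDh hc_neg 1 ν
      (fun _ ↦ 1) (fun _ ↦ one_pos)
    obtain ⟨-, hsmul, -⟩ := stub_fourierCoeff_linear F (h * Ds) (h * Ds) hc_hDs hc_hDs (-1) ν
      (fun _ ↦ 1) (fun _ ↦ one_pos)
    have hBr' : Br = s * Dh + (-1 : ℂ) • (h * Ds) := by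
      rw [hBr, neg_one_smul, sub_eq_add_neg]
    simp only [fourierCoeff_eq]
    rw [hBr', hadd, hsmul]
    ring
  -- the transformation law of the bracket (stub X2)
  set w : (F →+* ℝ) → ℤ := fun σ' ↦ (2 : ℤ) + (Pi.single σ (2 : ℤ) : (F →+* ℝ) → ℤ) σ' with hw
  have hlawBr : ∀ γ ∈ Bianchi.Gamma1 𝔫₂, ∀ z ∈ halfSpace F,
      Br (moeb (toSL2F γ) z) = autFactor w (toSL2F γ) z * Br z := by
    intro γ hγ z hz
    have hfγ := (mem_modularForms_iff.mp hs).transform γ hγ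
    have hgγ := (mem_modularForms_iff.mp hh₂).transform γ hγ
    obtain ⟨-, hbr⟩ := stub_slice_deriv_law F (fun _ ↦ (1 : ℤ)) (fun _ ↦ (1 : ℤ)) σ s h hs_hol hh_hol (toSL2F γ)
      hfγ hgγ
    have key := hbr z hz
    have hw' : ((fun _ : F →+* ℝ ↦ (1 : ℤ)) + (fun _ ↦ (1 : ℤ)) + Pi.single σ 2) = w := by
      funext σ'
      simp only [hw, Pi.add_apply]
      ring
    rw [hw'] at key
    simp only [Int.cast_one, one_mul] at key
    simp only [hBr, Pi.sub_apply, Pi.mul_apply, hDh, hDs]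
    exact key
  -- the scaled form `B = 1_ℍ · c · Br`
  set c : ℂ := (2 * Real.pi * I)⁻¹ * ((NumberField.discr F : ℤ) : ℂ) with hc
  have hc0 : c ≠ 0 := by
    refine mul_ne_zero (inv_ne_zero ?_) (Int.cast_ne_zero.2 (NumberField.discr_ne_zero F))
    exact mul_ne_zero (mul_ne_zero two_ne_zero (Complex.ofReal_ne_zero.2 Real.pi_ne_zero)) Complex.I_ne_zero
  set B : Point F → ℂ := (halfSpace F).indicator (fun z ↦ c * Br z) with hB
  have hBeq : ∀ z ∈ halfSpace F, B z = c * Br z := fun z hz ↦ Set.indicator_of_mem hz _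
  have hcBr_hol : IsHolomorphicOn F (fun z ↦ c * Br z) := (differentiableOn_const c).mul hBr_hol
  have hB_hol : IsHolomorphicOn F B := ts_isHolomorphicOn_congr hBeq hcBr_hol
  have hB_law : ∀ γ ∈ Bianchi.Gamma1 𝔫₂, ∀ z ∈ halfSpace F,
      B (moeb (toSL2F γ) z) = autFactor w (toSL2F γ) z * B z := fun γ hγ z hz ↦ by
    rw [hBeq z hz, hBeq _ (slm_moeb_mem_halfSpace _ hz), hlawBr γ hγ z hz]
    ring
  have hB_zero : ∀ z ∉ halfSpace F, B z = 0 := fun z hz ↦ Set.indicator_of_notMem hz _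
  have hB_mod : IsModularForm (Bianchi.Gamma1 𝔫₂) w B :=
    koecherPrinciple F hd 𝔫₂ h𝔫₂ _ (Bianchi.Gamma_le_Gamma1 _) _ B hB_hol hB_law hB_zero
  have hB_coeff : ∀ ν : F, fourierCoeff B ν = c * fourierCoeff Br ν := by
    intro ν
    rw [ts_fourierCoeff_congr hBeq ν, fourierCoeff_eq, fourierCoeff_eq]
    exact fourierCoeffAt_const_mul c Br ν _
  -- the coefficient functions of the bracket
  set a : F → ℂ := qExpansion s with ha
  set b : F → ℂ := qExpansion h with hb
  set a' : F → ℂ := fun ν ↦ 2 * Real.pi * I * ((σ ν : ℝ) : ℂ) * qExpansion s ν with ha'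
  set b' : F → ℂ := fun ν ↦ 2 * Real.pi * I * ((σ ν : ℝ) : ℂ) * qExpansion h ν with hb'
  set cf : F → ℂ := fun ν ↦ ∑ μ ∈ T ν, (a μ.1 * b' μ.2 - b μ.1 * a' μ.2) with hcf
  have hBr_cf : ∀ ν : F, ν ∈ D → fourierCoeff Br ν = cf ν := by
    intro ν hν
    rw [hBr_coeff ν, hc1 ν hν, hc2 ν hν, hcf]
    dsimp only
    rw [← Finset.sum_sub_distrib]
    refine Finset.sum_congr rfl fun μ hμ ↦ ?_
    obtain ⟨h1, h2, -⟩ := (hT ν μ).1 hμ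
    simp only [ha, hb, hb', ha', qExpansion_of_mem h1, qExpansion_of_mem h2, hDh_coeff μ.2 h2.1, hDs_coeff μ.2 h2.1]
  -- (1) `B` does not vanish identically: the leading coefficient (stub X4 at a generic height)
  have hBnz : ∃ z ∈ halfSpace F, B z ≠ 0 := by
    obtain ⟨y, hy, hinj⟩ := stub_generic_height F
    obtain ⟨lam, hlam⟩ := tx_height_hom F y
    have hlam_inj : Function.Injective lam := by
      intro μ μ' hμ
      rw [hlam, hlam] at hμ
      exact hinj hμ
    have hpos : ∀ ν ∈ qIndexSet F, ν ≠ 0 → 0 < lam ν := by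
      intro ν hν hν0
      rw [hlam]
      have htp : ∀ σ' : F →+* ℝ, 0 < σ' ν := (mem_qIndexSet_iff.1 hν).2.resolve_left hν0
      haveI : Nonempty (F →+* ℝ) := gh_nonempty_realEmbedding F
      exact Finset.sum_pos (fun σ' _ ↦ mul_pos (hy σ') (htp σ')) Finset.univ_nonempty
    have ha_supp : ∀ ν, a ν ≠ 0 → ν ∈ qIndexSet F := fun ν hν ↦ sle_mem_qIndexSet_of_qExpansion_ne_zero hν
    have hb_supp : ∀ ν, b ν ≠ 0 → ν ∈ qIndexSet F := fun ν hν ↦ sle_mem_qIndexSet_of_qExpansion_ne_zero hν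
    have ha0 : a 0 = 0 := by rw [ha, qExpansion_of_mem zero_mem_qIndexSet, hs0]
    have ha'a : ∀ ν, a' ν ≠ 0 → a ν ≠ 0 := fun ν hν h0 ↦ by
      apply hν
      simp only [ha'] at h0 ⊢
      rw [← ha, h0, mul_zero]
    have hb'supp : ∀ ν, b' ν ≠ 0 → ν ∈ qIndexSet F := fun ν hν ↦ by
      refine hb_supp ν fun h0 ↦ hν ?_
      simp only [hb'] at h0 ⊢
      rw [← hb, h0, mul_zero]
    have hb'0 : b' 0 = 0 := by simp only [hb', map_zero, Complex.ofReal_zero, mul_zero, zero_mul]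
    have hcf' : ∀ (ν : F) (T' : Finset (F × F)),
        (∀ μ : F × F, μ ∈ T' ↔ μ.1 ∈ qIndexSet F ∧ μ.2 ∈ qIndexSet F ∧ μ.1 + μ.2 = ν) →
        cf ν = ∑ μ ∈ T', (a μ.1 * b' μ.2 - b μ.1 * a' μ.2) := fun ν T' hT' ↦ by
      rw [hTuniq ν T' hT']
    -- a non-zero coefficient of `s`, then the `λ`-minimal one
    obtain ⟨ν₁, hν₁D, hν₁⟩ := tx_exists_coeff_ne_zero F s hs_hol hs_per hsnz
    have hν₁q : ν₁ ∈ qIndexSet F := by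
      by_contra hq
      exact hν₁ (hs_supp ν₁ hν₁D hq)
    have haν₁ : a ν₁ ≠ 0 := by rwa [ha, qExpansion_of_mem hν₁q]
    obtain ⟨νa, hνa, hmin⟩ := ssp_exists_height_min y hy a ha_supp ν₁ haν₁
    have hmina : ∀ ν, a ν ≠ 0 → lam νa ≤ lam ν := fun ν hν ↦ by rw [hlam, hlam]; exact hmin ν hν
    have hlead := stub_bracket_lead_coeff F lam hlam_inj hpos a b a' b' cf ha_supp hb_supp ha0 ha'a hb'supp hb'0
      hcf' νa hνa hmina
    -- the leading coefficient is non-zero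
    have hνaq : νa ∈ qIndexSet F := ha_supp νa hνa
    have hνa0 : νa ≠ 0 := fun h0 ↦ hνa (h0 ▸ ha0)
    have hσνa : 0 < σ νa := (mem_qIndexSet_iff.1 hνaq).2.resolve_left hνa0 σ
    have hb0 : b 0 ≠ 0 := by rwa [hb, qExpansion_of_mem zero_mem_qIndexSet]
    have ha'νa : a' νa ≠ 0 := by
      simp only [ha']
      refine mul_ne_zero (mul_ne_zero ?_ (Complex.ofReal_ne_zero.2 hσνa.ne')) hνa
      exact mul_ne_zero (mul_ne_zero two_ne_zero (Complex.ofReal_ne_zero.2 Real.pi_ne_zero)) Complex.I_ne_zero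
    have hcfνa : cf νa ≠ 0 := by
      rw [hlead]
      exact neg_ne_zero.2 (mul_ne_zero hb0 ha'νa)
    have hBνa : fourierCoeff B νa ≠ 0 := by
      rw [hB_coeff νa, hBr_cf νa hνaq.1]
      exact mul_ne_zero hc0 hcfνa
    by_contra hall
    push Not at hall
    exact hBνa (sle_fourierCoeff_eq_zero_of_eqOn hall νa)
  -- (2) `E`-data (stub X5)
  have hG : ∀ ν ∈ qIndexSet F, ∀ T' : Finset (F × F),
      (∀ μ : F × F, μ ∈ T' ↔ μ.1 ∈ qIndexSet F ∧ μ.2 ∈ qIndexSet F ∧ μ.1 + μ.2 = ν) →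
      fourierCoeff B ν = ∑ μ ∈ T', ((σ ((NumberField.discr F : F) * μ.2) : ℝ) : ℂ) *
        (((fun _ : F →+* ℝ ↦ (1 : ℤ)) σ : ℂ) * (zs μ.1 : ℂ) * (zh μ.2 : ℂ) -
          ((fun _ : F →+* ℝ ↦ (1 : ℤ)) σ : ℂ) * (zh μ.1 : ℂ) * (zs μ.2 : ℂ)) := by
    intro ν hν T' hT'
    rw [hTuniq ν T' hT', hB_coeff ν, hBr_coeff ν, hc1 ν hν.1, hc2 ν hν.1, ← Finset.sum_sub_distrib, Finset.mul_sum]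
    refine Finset.sum_congr rfl fun μ hμ ↦ ?_
    obtain ⟨h1, h2, -⟩ := (hT ν μ).1 hμ
    rw [hzs μ.1 h1, hzh μ.1 h1, hDh_coeff μ.2 h2.1, hDs_coeff μ.2 h2.1, hzh μ.2 h2, hzs μ.2 h2, hc]
    have h2πI : (2 * Real.pi * I : ℂ) ≠ 0 :=
      mul_ne_zero (mul_ne_zero two_ne_zero (Complex.ofReal_ne_zero.2 Real.pi_ne_zero)) Complex.I_ne_zero
    simp only [map_mul, map_intCast, Int.cast_one, one_mul]
    field_simp
    push_cast
    ring
  -- the majorant: the cone convolutions of `|zs|`, `|zh|` are tube-summable (stub X6 with the Fourier expansions of `s`, `h`)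
  have hmaj : ∀ y : (F →+* ℝ) → ℝ, (∀ σ', 0 < y σ') →
      Summable (fun ν : D ↦
        (∑ μ ∈ (stub_finite_qIndex_antidiagonal F (ν : F)).toFinset,
            (|(zs μ.1 : ℝ)| * |(zh μ.2 : ℝ)| + |(zh μ.1 : ℝ)| * |(zs μ.2 : ℝ)|)) *
          Real.exp (-(2 * Real.pi * ∑ σ' : F →+* ℝ, σ' (ν : F) * y σ'))) := by
    classical
    set α : F → ℝ := fun μ ↦ if μ ∈ qIndexSet F then |(zs μ : ℝ)| else 0 with hα
    set β : F → ℝ := fun μ ↦ if μ ∈ qIndexSet F then |(zh μ : ℝ)| else 0 with hβ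
    have hα0 : ∀ μ, 0 ≤ α μ := fun μ ↦ by simp only [hα]; split_ifs <;> simp
    have hβ0 : ∀ μ, 0 ≤ β μ := fun μ ↦ by simp only [hβ]; split_ifs <;> simp
    -- tube summability of `α`, `β` from the Fourier expansions
    have hsum : ∀ (f : Point F → ℂ) (zf : F → ℤ), IsHolomorphicOn F f →
        (∀ (a : 𝓞 F) (z : Point F), z ∈ halfSpace F → f (fun σ ↦ z σ + ((σ (a : F) : ℝ) : ℂ)) = f z) →
        (∀ ν ∈ qIndexSet F, fourierCoeff f ν = (zf ν : ℂ)) →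
        ∀ y : (F →+* ℝ) → ℝ, (∀ σ, 0 < y σ) →
          Summable (fun ν : D ↦ (if (ν : F) ∈ qIndexSet F then |(zf ν : ℝ)| else 0) *
            Real.exp (-(2 * Real.pi * ∑ σ' : F →+* ℝ, σ' (ν : F) * y σ'))) := by
      intro f zf hf hper hzf y hy
      have hz : (fun σ ↦ ((y σ : ℝ) : ℂ) * I : Point F) ∈ halfSpace F := fun σ ↦ by simpa using hy σ
      have h2 := (hasSum_fourierCoeff F f hf hper _ hz).2
      simp only [mul_I_im, Complex.ofReal_re] at h2
      refine h2.of_nonneg_of_le (fun ν ↦ mul_nonneg (by split_ifs <;> simp) (Real.exp_pos _).le) fun ν ↦ ?_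
      refine mul_le_mul_of_nonneg_right ?_ (Real.exp_pos _).le
      split_ifs with hq
      · rw [hzf _ hq, Complex.norm_intCast]
      · exact norm_nonneg _
    have hαs := hsum s zs hs_hol hs_per hzs
    have hβs := hsum h zh hh_hol hh_per hzh
    intro y hy
    have h1 := stub_cauchy_product_tube F α β hα0 hβ0 hαs hβs y hy
    have h2 := stub_cauchy_product_tube F β α hβ0 hα0 hβs hαs y hy
    refine ((h1.add h2).congr fun ν ↦ ?_)
    rw [← add_mul, ← Finset.sum_add_distrib]
    congr 1
    refine Finset.sum_congr rfl fun μ hμ ↦ ?_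
    obtain ⟨hμ1, hμ2, -⟩ := (hT ν μ).1 hμ
    simp only [hα, hβ, if_pos hμ1, if_pos hμ2]
  obtain ⟨qB, hqB, hqBi, hqBs⟩ := stub_bracket_Edata F hd 𝔫₂ h𝔫₂ E τ ι σ hι (fun _ ↦ (1 : ℤ)) (fun _ ↦ (1 : ℤ)) s h
    hs hh₂ zs zh hzs hzh hmaj B hG
  exact ⟨B, mem_modularForms_iff.2 hB_mod, hBnz, qB, hqB, hqBi, hqBs⟩


end Summit.Langlands.Langlands.Theorems.HilbertIntegralOverconvergentIsCongruence
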